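import Mathlib
import Literature.MathematicalPhysics.StatisticalMechanics.Crystallization
import Literature.MathematicalPhysics.StatisticalMechanics.LennardJonesClusters
import Literature.MathematicalPhysics.StatisticalMechanics.OneCrossingMixture
import Summits.AtomisticToContinuum.Crystallization.Theses.ReggeStarCoercivity

/-!
# Route `ReggeStarCoercivity`, crux stmt-AtomisticToContinuum-13601 `StabilityConstantTwelve`
# — line `Sketch`, stub `stub_gaussSum_mono` (Gaussian monotonicity)

For every finite configuration `x : Fin N → ℝ³` the function
`t ↦ t^{3/2} Σ_{i,j} e^{-t |x_i - x_j|²}` is non-decreasing on `(0, ∞)`.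

Proof: the Gaussian Fourier representation on `ℝ³` (Mathlib
`GaussianFourier.integral_cexp_neg_mul_sq_norm_add_of_euclideanSpace` with `b = (4t)⁻¹`,
`c = i`) gives `(4π)^{3/2} t^{3/2} e^{-t|w|²} = ∫ e^{-|v|²/(4t)} e^{i⟨w,v⟩} dv`, and
`Σ_{i,j} e^{i⟨x_i - x_j, v⟩} = |Σ_i e^{i⟨x_i,v⟩}|² ≥ 0`, so that
`(4π)^{3/2} t^{3/2} Σ_{i,j} e^{-t|x_i-x_j|²} = ∫ e^{-|v|²/(4t)} |Σ_i e^{i⟨x_i,v⟩}|² dv`,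
whose integrand is pointwise non-decreasing in `t`.
-/

noncomputable section

namespace Summit.AtomisticToContinuum.Crystallization.Theorems

open MeasureTheory Set Real
open scoped Nat
open Literature.MathematicalPhysics.StatisticalMechanics

open scoped InnerProductSpace ComplexConjugate

/-- Oscillatory Gaussian integral on `ℝ³` in closed real form:
`∫ e^{-|v|²/(4t)} e^{i⟨w,v⟩} dv = (4πt)^{3/2} e^{-t|w|²}` for `t > 0`. -/
theorem gaussSumMono_integral {t : ℝ} (ht : 0 < t) (w : EuclideanSpace ℝ (Fin 3)) :
    ∫ v : EuclideanSpace ℝ (Fin 3),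
        Complex.exp (-(((4 * t)⁻¹ : ℝ) : ℂ) * ‖v‖ ^ 2 + Complex.I * ⟪w, v⟫_ℝ) =
      (((4 * π * t) ^ ((3 : ℝ) / 2) * rexp (-(t * ‖w‖ ^ 2)) : ℝ) : ℂ) := by
  have hb : 0 < (((4 * t)⁻¹ : ℝ) : ℂ).re := by
    rw [Complex.ofReal_re]
    positivity
  rw [GaussianFourier.integral_cexp_neg_mul_sq_norm_add_of_euclideanSpace hb Complex.I w,
    Fintype.card_fin, Complex.I_sq]
  have h1 : (π : ℂ) / (((4 * t)⁻¹ : ℝ) : ℂ) = ((4 * π * t : ℝ) : ℂ) := by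
    rw [← Complex.ofReal_div, div_inv_eq_mul]
    push_cast
    ring
  have h2 : ((3 : ℕ) : ℂ) / 2 = (((3 : ℝ) / 2 : ℝ) : ℂ) := by
    push_cast
    ring
  have h3 : (-1 * (‖w‖ : ℂ) ^ 2 / (4 * (((4 * t)⁻¹ : ℝ) : ℂ))) =
      ((-(t * ‖w‖ ^ 2) : ℝ) : ℂ) := by
    have ht' : (t : ℂ) ≠ 0 := Complex.ofReal_ne_zero.mpr ht.ne'
    push_cast
    field_simp
  rw [h1, h2, ← Complex.ofReal_cpow (by positivity), h3, Complex.ofReal_mul, Complex.ofReal_exp]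

/-- The double character sum is a squared modulus:
`Σ_{i,j} e^{-b|v|²} e^{i⟨x_i - x_j, v⟩} = e^{-b|v|²} |Σ_i e^{i⟨x_i, v⟩}|²`. -/
theorem gaussSumMono_integrand {N : ℕ} (x : Fin N → EuclideanSpace ℝ (Fin 3)) (b : ℝ) :
    (fun v : EuclideanSpace ℝ (Fin 3) =>
        (((rexp (-b * ‖v‖ ^ 2) *
          Complex.normSq (∑ i, Complex.exp (Complex.I * ⟪x i, v⟫_ℝ))) : ℝ) : ℂ)) =
      fun v => ∑ i, ∑ j,
        Complex.exp (-(b : ℂ) * ‖v‖ ^ 2 + Complex.I * ⟪x i - x j, v⟫_ℝ) := by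
  funext v
  simp_rw [Complex.exp_add, ← Finset.mul_sum]
  push_cast
  congr 1
  rw [← Complex.mul_conj, map_sum, Finset.sum_mul_sum]
  refine Finset.sum_congr rfl fun i _ => Finset.sum_congr rfl fun j _ => ?_
  rw [← Complex.exp_conj, map_mul, Complex.conj_ofReal, Complex.conj_I, ← Complex.exp_add,
    inner_sub_left]
  push_cast
  ring_nf

/-- Integrability of the oscillatory Gaussian `v ↦ e^{-|v|²/(4t)} e^{i⟨w,v⟩}` on `ℝ³`. -/
theorem gaussSumMono_integrable {t : ℝ} (ht : 0 < t) (w : EuclideanSpace ℝ (Fin 3)) :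
    Integrable fun v : EuclideanSpace ℝ (Fin 3) =>
      Complex.exp (-(((4 * t)⁻¹ : ℝ) : ℂ) * ‖v‖ ^ 2 + Complex.I * ⟪w, v⟫_ℝ) := by
  have hb : 0 < (((4 * t)⁻¹ : ℝ) : ℂ).re := by
    rw [Complex.ofReal_re]
    positivity
  exact GaussianFourier.integrable_cexp_neg_mul_sq_norm_add_of_euclideanSpace hb Complex.I w

/-- Gaussian Fourier representation of the weighted Gaussian pair sum:
`(4π)^{3/2} t^{3/2} Σ_{i,j} e^{-t|x_i-x_j|²} = ∫ e^{-|v|²/(4t)} |Σ_i e^{i⟨x_i,v⟩}|² dv`. -/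
theorem gaussSumMono_repr (N : ℕ) (x : Fin N → EuclideanSpace ℝ (Fin 3)) {t : ℝ}
    (ht : 0 < t) :
    (4 * π) ^ ((3 : ℝ) / 2) *
        (t ^ ((3 : ℝ) / 2) * ∑ i, ∑ j, rexp (-(t * ‖x i - x j‖ ^ 2))) =
      ∫ v : EuclideanSpace ℝ (Fin 3), rexp (-(4 * t)⁻¹ * ‖v‖ ^ 2) *
        Complex.normSq (∑ i, Complex.exp (Complex.I * ⟪x i, v⟫_ℝ)) := by
  have hL : (4 * π) ^ ((3 : ℝ) / 2) *
        (t ^ ((3 : ℝ) / 2) * ∑ i, ∑ j, rexp (-(t * ‖x i - x j‖ ^ 2))) =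
      ∑ i, ∑ j, (4 * π * t) ^ ((3 : ℝ) / 2) * rexp (-(t * ‖x i - x j‖ ^ 2)) := by
    rw [Real.mul_rpow (by positivity) ht.le, ← mul_assoc, Finset.mul_sum]
    refine Finset.sum_congr rfl fun i _ => ?_
    rw [Finset.mul_sum]
  rw [hL]
  apply Complex.ofReal_injective
  rw [← integral_complex_ofReal, gaussSumMono_integrand x (4 * t)⁻¹,
    integral_finsetSum _ fun i _ => integrable_finsetSum _ fun j _ =>
      gaussSumMono_integrable ht (x i - x j),
    Complex.ofReal_sum]
  refine Finset.sum_congr rfl fun i _ => ?_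
  rw [integral_finsetSum _ fun j _ => gaussSumMono_integrable ht (x i - x j),
    Complex.ofReal_sum]
  refine Finset.sum_congr rfl fun j _ => ?_
  exact (gaussSumMono_integral ht (x i - x j)).symm

/-- Integrability of `v ↦ e^{-|v|²/(4t)} |Σ_i e^{i⟨x_i,v⟩}|²` on `ℝ³` for `t > 0`. -/
theorem gaussSumMono_integrable_normSq (N : ℕ) (x : Fin N → EuclideanSpace ℝ (Fin 3)) {t : ℝ}
    (ht : 0 < t) :
    Integrable fun v : EuclideanSpace ℝ (Fin 3) => rexp (-(4 * t)⁻¹ * ‖v‖ ^ 2) *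
        Complex.normSq (∑ i, Complex.exp (Complex.I * ⟪x i, v⟫_ℝ)) := by
  have hS : Integrable fun v : EuclideanSpace ℝ (Fin 3) => ∑ i, ∑ j,
      Complex.exp (-(((4 * t)⁻¹ : ℝ) : ℂ) * ‖v‖ ^ 2 + Complex.I * ⟪x i - x j, v⟫_ℝ) :=
    integrable_finsetSum _ fun i _ => integrable_finsetSum _ fun j _ =>
      gaussSumMono_integrable ht (x i - x j)
  rw [← gaussSumMono_integrand x (4 * t)⁻¹] at hS
  refine hS.re.congr (ae_of_all _ fun v => ?_)
  simp only [RCLike.re_to_complex, Complex.ofReal_re]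

/-- STUB S3b (Gaussian monotonicity). For every finite configuration in `ℝ³`,
`t ↦ t^{3/2} Σ_{i,j} e^{-t |x_i - x_j|²}` is non-decreasing on `(0, ∞)`:
`t^{3/2} e^{-t|w|²} = π^{3/2} ∫ e^{-π²|v|²/t} e^{2πi⟨w,v⟩} dv` and
`Σ_{i,j} e^{2πi⟨x_i - x_j, v⟩} = |Σ_i e^{2πi⟨x_i,v⟩}|² ≥ 0`. -/
theorem stub_gaussSum_mono (N : ℕ) (x : Fin N → EuclideanSpace ℝ (Fin 3)) {t₁ t₂ : ℝ}
    (ht₁ : 0 < t₁) (h : t₁ ≤ t₂) :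
    t₁ ^ ((3 : ℝ) / 2) * ∑ i, ∑ j, Real.exp (-(t₁ * ‖x i - x j‖ ^ 2)) ≤
      t₂ ^ ((3 : ℝ) / 2) * ∑ i, ∑ j, Real.exp (-(t₂ * ‖x i - x j‖ ^ 2)) := by
  have ht₂ : 0 < t₂ := lt_of_lt_of_le ht₁ h
  have hC : 0 < (4 * π) ^ ((3 : ℝ) / 2) := by positivity
  refine le_of_mul_le_mul_left ?_ hC
  rw [gaussSumMono_repr N x ht₁, gaussSumMono_repr N x ht₂]
  refine integral_mono (gaussSumMono_integrable_normSq N x ht₁)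
    (gaussSumMono_integrable_normSq N x ht₂) fun v => ?_
  refine mul_le_mul_of_nonneg_right (Real.exp_le_exp.mpr ?_) (Complex.normSq_nonneg _)
  refine mul_le_mul_of_nonneg_right (neg_le_neg ?_) (sq_nonneg _)
  exact inv_anti₀ (by positivity) (by linarith)

end Summit.AtomisticToContinuum.Crystallization.Theorems
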